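import Summits.QuantumFields.BalabanUV.Beta.GAN24.NestedBackgroundLoopEnd

/-!
# `BalabanUV.Beta.GAN24.PlantedTwoWordLaw` — binder row G-an2-4 ∕ (CONV-C), routes C-R6° («VALUES») × R7 («TWO CURRENCIES»), PART 221:
# THE ONE-STEP AVERAGED LAW OF THE TWO-INSERTION WORD `G·D₁·W₁·D₂·W₂` FROM THE PLANTED LAWS OF `G`, `W₁`, `W₂` AND TWO NESTED BOUNDED MULTIPLIERS (`D₁′J = JD₁`, `D₂′J = JD₂`):
# `‖ÃT′Ãᴴ − T‖ ≤ (ακ)²p_G + 2gα²κ·p_W + f(ακ)² + gα²κ·f_W`; along a tower `OneStepAveragedLaw` ∕ `TowerLimitRate` — PART 217 for the two-vertex word `𝒢P_i𝒢P_j𝒢` of census V196's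
# second tadpole, for bounded nested backgrounds (unit b2b-balaban-gan24-p3, gen 63; v1)

NOT IN PRINT; OUR PROOF ([folklore] finite-dimensional operator algebra in the `ℓ²`-operator norm; PART 217 (`sandwich_eq`'s pattern), `Spine/CovariantAveragingTower` (`OneStepAveragedLaw`,
`TowerLimitRate`, `towerLimitRate_of_oneStepAveragedLaw`), `Spine/BackgroundResolventTower` (`FreeTowerLaws`, `opNorm_normalised_le`) BY NAME; [King1986] Lemma 4.5 (4.32) p. 674 is the
printed pattern, method reference only; nothing printed is a hypothesis).
HONEST FRAMING (cell contract, verbatim): «discharging `BetaPertH` makes Bałaban's UV stability UNCONDITIONAL — a real constructive-QFT result; it is NOT the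
continuum limit and NOT the Clay problem.»  HONEST DEPENDENCY (verbatim): «continuum YM on T⁴ ⇐ BetaPertH ∧ nine spine estimates (0/9 proved); BetaPertH ⇐
(D1) ∧ (D4) ∧ CAP+tail; G-an2-4 gates asym, D1 and NE2/3/4.»

WHAT THIS FILE PROVES (0 sorry, 0 `def`, nothing cited; `G, D₁, D₂, W₁, W₂, F : n × n`, primed `: m × m`, `J : m × n`, `Ã : n × m` ANY complex matrices):
* §1 **`planted_twoWord_eq`** (EXACT; `JᴴJ = 1`, `Dᵢ′J = JDᵢ`): `G′D₁′W₁′D₂′W₂′ − J(GD₁W₁D₂W₂)Jᴴ = (G′ − Ĝ)D₁′W₁′D₂′W₂′ + ĜD₁′(W₁′ − Ŵ₁)D₂′W₂′ + ĜD₁′Ŵ₁D₂′(W₂′ − Ŵ₂)`, `Ĝ = JGJᴴ`, `Ŵᵢ = JWᵢJᴴ`;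
  `sandwich₂_eq` (EXACT; `ÃJ = 1 + F`).
* §2 **`opNorm_planted_twoWord_sandwich_le`**: `‖Ã(G′D₁′W₁′D₂′W₂′)Ãᴴ − GD₁W₁D₂W₂‖ ≤ (ακ)(ακ)p_G + gα(ακ)p_W + gακα·p_W + f(ακ)(ακ) + gακα·f_W`.
* §3 ALONG A TOWER (`FreeTowerLaws Δ A J F r e₀ e₁ f` for `Ã, J, F, f`): **`oneStepAveragedLaw_plantedTwoWord`**, **`towerLimitRate_plantedTwoWord`**.
WHAT IT DOES NOT DO: the instance (PART 222).
SUPPLIER work; NEVER «G-an2-4 closed»; NOT (CONV-C), NOT D1, NOT `BetaPertH`, NOT continuum, NOT Clay.  Records: `HOME/b2b-balaban-gan24-p3/gen63/README.md`.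
-/

noncomputable section

open scoped BigOperators ComplexConjugate Matrix Matrix.Norms.L2Operator
open Filter Topology

namespace Summit.QuantumFields.BalabanUV.Beta.GAN24.PlantedTwoWordLaw

open Summit.QuantumFields.BalabanUV.T4Continuum
open Summit.QuantumFields.BalabanUV.T4Continuum.CovariantAveragingTower (OneStepAveragedLaw TowerLimitRate towerLimitRate_of_oneStepAveragedLaw)
open Summit.QuantumFields.BalabanUV.T4Continuum.BackgroundResolventTower (FreeTowerLaws opNorm_normalised_le)

/-! ## §1 The exact identities -/

section TwoLevel

variable {m n : Type*} [Fintype m] [DecidableEq m] [Fintype n] [DecidableEq n]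
variable {G D₁ D₂ W₁ W₂ : Matrix n n ℂ} {G' D₁' D₂' W₁' W₂' : Matrix m m ℂ} {J : Matrix m n ℂ}

omit [DecidableEq m] in
/-- **`planted_twoWord_eq` — THE PLANTED DEFECT OF THE TWO-INSERTION WORD TELESCOPES THROUGH THE THREE ITEMS** (EXACT; `JᴴJ = 1`, `D₁′J = JD₁`, `D₂′J = JD₂`):
`G′D₁′W₁′D₂′W₂′ − J(GD₁W₁D₂W₂)Jᴴ = (G′ − JGJᴴ)·D₁′W₁′D₂′W₂′ + JGJᴴ·D₁′·(W₁′ − JW₁Jᴴ)·D₂′W₂′ + JGJᴴ·D₁′·JW₁Jᴴ·D₂′·(W₂′ − JW₂Jᴴ)`. [our proof] -/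
theorem planted_twoWord_eq (hJJ : Jᴴ * J = 1) (h₁ : D₁' * J = J * D₁) (h₂ : D₂' * J = J * D₂) :
    G' * D₁' * W₁' * D₂' * W₂' - J * (G * D₁ * W₁ * D₂ * W₂) * Jᴴ
      = (G' - J * G * Jᴴ) * (D₁' * W₁' * D₂' * W₂') + J * G * Jᴴ * D₁' * (W₁' - J * W₁ * Jᴴ) * (D₂' * W₂')
        + J * G * Jᴴ * D₁' * (J * W₁ * Jᴴ) * D₂' * (W₂' - J * W₂ * Jᴴ) := by
  have key : J * G * Jᴴ * D₁' * (J * W₁ * Jᴴ) * D₂' * (J * W₂ * Jᴴ) = J * (G * D₁ * W₁ * D₂ * W₂) * Jᴴ := by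
    calc J * G * Jᴴ * D₁' * (J * W₁ * Jᴴ) * D₂' * (J * W₂ * Jᴴ)
        = J * G * (Jᴴ * (D₁' * J)) * W₁ * (Jᴴ * (D₂' * J)) * W₂ * Jᴴ := by simp only [Matrix.mul_assoc]
      _ = J * G * (Jᴴ * (J * D₁)) * W₁ * (Jᴴ * (J * D₂)) * W₂ * Jᴴ := by rw [h₁, h₂]
      _ = J * G * ((Jᴴ * J) * D₁) * W₁ * ((Jᴴ * J) * D₂) * W₂ * Jᴴ := by simp only [Matrix.mul_assoc]
      _ = J * (G * D₁ * W₁ * D₂ * W₂) * Jᴴ := by rw [hJJ, Matrix.one_mul, Matrix.one_mul]; simp only [Matrix.mul_assoc]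
  rw [← key]
  simp only [Matrix.sub_mul, Matrix.mul_sub, Matrix.mul_assoc]
  abel

omit [DecidableEq m] in
/-- **`sandwich₂_eq` — THE SANDWICH IDENTITY WITH THE PAIRING `ÃJ = 1 + F`** (EXACT): `T = GD₁W₁D₂W₂`, any `T′`:
`ÃT′Ãᴴ − T = Ã(T′ − JTJᴴ)Ãᴴ + (FG)(D₁W₁D₂W₂)(ÃJ)ᴴ + GD₁W₁D₂(W₂Fᴴ)`. [our proof] -/
theorem sandwich₂_eq {At : Matrix n m ℂ} {F : Matrix n n ℂ} (hAJ : At * J = 1 + F) (T' : Matrix m m ℂ) :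
    At * T' * Atᴴ - G * D₁ * W₁ * D₂ * W₂
      = At * (T' - J * (G * D₁ * W₁ * D₂ * W₂) * Jᴴ) * Atᴴ + F * G * (D₁ * W₁ * D₂ * W₂) * (At * J)ᴴ + G * D₁ * W₁ * D₂ * (W₂ * Fᴴ) := by
  set T : Matrix n n ℂ := G * D₁ * W₁ * D₂ * W₂ with hTdef
  have e2 : At * (J * T * Jᴴ) * Atᴴ = (At * J) * T * (At * J)ᴴ := by
    rw [Matrix.conjTranspose_mul]; simp only [Matrix.mul_assoc]
  have e : At * T' * Atᴴ - T = At * (T' - J * T * Jᴴ) * Atᴴ + F * T * (At * J)ᴴ + T * Fᴴ := by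
    rw [Matrix.mul_sub, Matrix.sub_mul, e2, hAJ, Matrix.conjTranspose_add, Matrix.conjTranspose_one]
    simp only [Matrix.add_mul, Matrix.mul_add, Matrix.one_mul, Matrix.mul_one]
    abel
  have eFT : F * T * (At * J)ᴴ = F * G * (D₁ * W₁ * D₂ * W₂) * (At * J)ᴴ := by rw [hTdef]; simp only [Matrix.mul_assoc]
  have eTF : T * Fᴴ = G * D₁ * W₁ * D₂ * (W₂ * Fᴴ) := by rw [hTdef]; simp only [Matrix.mul_assoc]
  rw [e, eFT, eTF]

end TwoLevel

/-! ## §2 The bound from the planted letters -/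

section Bound

variable {m n : Type*} [Fintype m] [DecidableEq m] [Fintype n] [DecidableEq n]
variable {G D₁ D₂ W₁ W₂ : Matrix n n ℂ} {G' D₁' D₂' W₁' W₂' : Matrix m m ℂ} {J : Matrix m n ℂ}

/-- **`opNorm_planted_twoWord_sandwich_le` — THE ONE-STEP SANDWICH LAW OF `GD₁W₁D₂W₂` FROM THE PLANTED LAWS OF `G`, `W₁`, `W₂` AND TWO NESTED BOUNDED MULTIPLIERS** [our proof]:
`‖G‖ ≤ g`, `‖Dᵢ‖, ‖Dᵢ′‖ ≤ α`, `‖Wᵢ‖, ‖Wᵢ′‖ ≤ κ`, `‖Ã‖, ‖J‖ ≤ 1`, `JᴴJ = 1`, `ÃJ = 1 + F`, `Dᵢ′J = JDᵢ`, `‖G′ − JGJᴴ‖ ≤ p_G`, `‖Wᵢ′ − JWᵢJᴴ‖ ≤ p_W`, `‖FG‖ ≤ f`, `‖W₂Fᴴ‖ ≤ f_W` ⟹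
`‖Ã(G′D₁′W₁′D₂′W₂′)Ãᴴ − GD₁W₁D₂W₂‖ ≤ (ακ)(ακ)·p_G + gα(ακ)·p_W + gακα·p_W + f·((ακ)(ακ)) + gακα·f_W`. -/
theorem opNorm_planted_twoWord_sandwich_le {g α κ pG pW f fW : ℝ} (hG : ‖G‖ ≤ g) (hD₁ : ‖D₁‖ ≤ α) (hD₁' : ‖D₁'‖ ≤ α) (hD₂ : ‖D₂‖ ≤ α) (hD₂' : ‖D₂'‖ ≤ α)
    (hW₁ : ‖W₁‖ ≤ κ) (hW₁' : ‖W₁'‖ ≤ κ) (hW₂ : ‖W₂‖ ≤ κ) (hW₂' : ‖W₂'‖ ≤ κ) {At : Matrix n m ℂ} (hAt : ‖At‖ ≤ 1) (hJ : ‖J‖ ≤ 1) (hJJ : Jᴴ * J = 1) {F : Matrix n n ℂ} (hAJ : At * J = 1 + F)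
    (h₁ : D₁' * J = J * D₁) (h₂ : D₂' * J = J * D₂) (hpG : ‖G' - J * G * Jᴴ‖ ≤ pG) (hpW₁ : ‖W₁' - J * W₁ * Jᴴ‖ ≤ pW) (hpW₂ : ‖W₂' - J * W₂ * Jᴴ‖ ≤ pW) (hF : ‖F * G‖ ≤ f) (hfW : ‖W₂ * Fᴴ‖ ≤ fW) :
    ‖At * (G' * D₁' * W₁' * D₂' * W₂') * Atᴴ - G * D₁ * W₁ * D₂ * W₂‖
      ≤ (α * κ) * (α * κ) * pG + g * α * (α * κ) * pW + g * α * κ * α * pW + f * ((α * κ) * (α * κ)) + g * α * κ * α * fW := by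
  have hg : 0 ≤ g := (norm_nonneg _).trans hG
  have hα : 0 ≤ α := (norm_nonneg _).trans hD₁
  have hκ : 0 ≤ κ := (norm_nonneg _).trans hW₁
  have hf : 0 ≤ f := (norm_nonneg _).trans hF
  have hpG0 : 0 ≤ pG := (norm_nonneg _).trans hpG
  have hpW0 : 0 ≤ pW := (norm_nonneg _).trans hpW₁
  have hAt' : ‖Atᴴ‖ ≤ 1 := by rw [Matrix.l2_opNorm_conjTranspose]; exact hAt
  have hJ' : ‖Jᴴ‖ ≤ 1 := by rw [Matrix.l2_opNorm_conjTranspose]; exact hJ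
  have hAJn : ‖(At * J)ᴴ‖ ≤ 1 := by
    rw [Matrix.l2_opNorm_conjTranspose]
    calc ‖At * J‖ ≤ ‖At‖ * ‖J‖ := Matrix.l2_opNorm_mul _ _
      _ ≤ 1 * 1 := mul_le_mul hAt hJ (norm_nonneg _) zero_le_one
      _ = 1 := one_mul 1
  -- planted items are bounded like the items
  have hJGJ : ‖J * G * Jᴴ‖ ≤ g := by
    calc ‖J * G * Jᴴ‖ ≤ ‖J * G‖ * ‖Jᴴ‖ := Matrix.l2_opNorm_mul _ _
      _ ≤ (‖J‖ * ‖G‖) * 1 := mul_le_mul (Matrix.l2_opNorm_mul _ _) hJ' (norm_nonneg _) (mul_nonneg (norm_nonneg _) (norm_nonneg _))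
      _ ≤ (1 * g) * 1 := mul_le_mul_of_nonneg_right (mul_le_mul hJ hG (norm_nonneg _) zero_le_one) zero_le_one
      _ = g := by ring
  have hJWJ : ‖J * W₁ * Jᴴ‖ ≤ κ := by
    calc ‖J * W₁ * Jᴴ‖ ≤ ‖J * W₁‖ * ‖Jᴴ‖ := Matrix.l2_opNorm_mul _ _
      _ ≤ (‖J‖ * ‖W₁‖) * 1 := mul_le_mul (Matrix.l2_opNorm_mul _ _) hJ' (norm_nonneg _) (mul_nonneg (norm_nonneg _) (norm_nonneg _))
      _ ≤ (1 * κ) * 1 := mul_le_mul_of_nonneg_right (mul_le_mul hJ hW₁ (norm_nonneg _) zero_le_one) zero_le_one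
      _ = κ := by ring
  -- products of bounded factors
  have hDW' : ‖D₂' * W₂'‖ ≤ α * κ := (Matrix.l2_opNorm_mul _ _).trans (mul_le_mul hD₂' hW₂' (norm_nonneg _) hα)
  have hD1W' : ‖D₁' * W₁'‖ ≤ α * κ := (Matrix.l2_opNorm_mul _ _).trans (mul_le_mul hD₁' hW₁' (norm_nonneg _) hα)
  have h4' : ‖D₁' * W₁' * D₂' * W₂'‖ ≤ (α * κ) * (α * κ) := by
    rw [Matrix.mul_assoc (D₁' * W₁')]
    exact (Matrix.l2_opNorm_mul _ _).trans (mul_le_mul hD1W' hDW' (norm_nonneg _) (mul_nonneg hα hκ))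
  have hDW : ‖D₂ * W₂‖ ≤ α * κ := (Matrix.l2_opNorm_mul _ _).trans (mul_le_mul hD₂ hW₂ (norm_nonneg _) hα)
  have hD1W : ‖D₁ * W₁‖ ≤ α * κ := (Matrix.l2_opNorm_mul _ _).trans (mul_le_mul hD₁ hW₁ (norm_nonneg _) hα)
  have h4 : ‖D₁ * W₁ * D₂ * W₂‖ ≤ (α * κ) * (α * κ) := by
    rw [Matrix.mul_assoc (D₁ * W₁)]
    exact (Matrix.l2_opNorm_mul _ _).trans (mul_le_mul hD1W hDW (norm_nonneg _) (mul_nonneg hα hκ))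
  have hGD1 : ‖J * G * Jᴴ * D₁'‖ ≤ g * α := (Matrix.l2_opNorm_mul _ _).trans (mul_le_mul hJGJ hD₁' (norm_nonneg _) hg)
  have hGD1W : ‖J * G * Jᴴ * D₁' * (J * W₁ * Jᴴ)‖ ≤ g * α * κ := (Matrix.l2_opNorm_mul _ _).trans (mul_le_mul hGD1 hJWJ (norm_nonneg _) (mul_nonneg hg hα))
  have hGD1WD : ‖J * G * Jᴴ * D₁' * (J * W₁ * Jᴴ) * D₂'‖ ≤ g * α * κ * α := (Matrix.l2_opNorm_mul _ _).trans (mul_le_mul hGD1W hD₂' (norm_nonneg _) (by positivity))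
  have hGD : ‖G * D₁‖ ≤ g * α := (Matrix.l2_opNorm_mul _ _).trans (mul_le_mul hG hD₁ (norm_nonneg _) hg)
  have hGDW : ‖G * D₁ * W₁‖ ≤ g * α * κ := (Matrix.l2_opNorm_mul _ _).trans (mul_le_mul hGD hW₁ (norm_nonneg _) (mul_nonneg hg hα))
  have hGDWD : ‖G * D₁ * W₁ * D₂‖ ≤ g * α * κ * α := (Matrix.l2_opNorm_mul _ _).trans (mul_le_mul hGDW hD₂ (norm_nonneg _) (by positivity))
  -- the planted defect of the word
  have hpl : ‖G' * D₁' * W₁' * D₂' * W₂' - J * (G * D₁ * W₁ * D₂ * W₂) * Jᴴ‖ ≤ (α * κ) * (α * κ) * pG + g * α * (α * κ) * pW + g * α * κ * α * pW := by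
    rw [planted_twoWord_eq hJJ h₁ h₂]
    refine (norm_add_le _ _).trans (add_le_add ((norm_add_le _ _).trans (add_le_add ?_ ?_)) ?_)
    · calc _ ≤ ‖G' - J * G * Jᴴ‖ * ‖D₁' * W₁' * D₂' * W₂'‖ := Matrix.l2_opNorm_mul _ _
        _ ≤ pG * ((α * κ) * (α * κ)) := mul_le_mul hpG h4' (norm_nonneg _) hpG0
        _ = (α * κ) * (α * κ) * pG := by ring
    · calc _ ≤ ‖J * G * Jᴴ * D₁' * (W₁' - J * W₁ * Jᴴ)‖ * ‖D₂' * W₂'‖ := Matrix.l2_opNorm_mul _ _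
        _ ≤ (‖J * G * Jᴴ * D₁'‖ * ‖W₁' - J * W₁ * Jᴴ‖) * (α * κ) := mul_le_mul (Matrix.l2_opNorm_mul _ _) hDW' (norm_nonneg _) (mul_nonneg (norm_nonneg _) (norm_nonneg _))
        _ ≤ (g * α * pW) * (α * κ) := mul_le_mul_of_nonneg_right (mul_le_mul hGD1 hpW₁ (norm_nonneg _) (mul_nonneg hg hα)) (mul_nonneg hα hκ)
        _ = g * α * (α * κ) * pW := by ring
    · exact (Matrix.l2_opNorm_mul _ _).trans (mul_le_mul hGD1WD hpW₂ (norm_nonneg _) (by positivity))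
  have hpl0 : 0 ≤ (α * κ) * (α * κ) * pG + g * α * (α * κ) * pW + g * α * κ * α * pW := (norm_nonneg _).trans hpl
  rw [sandwich₂_eq hAJ]
  refine (norm_add_le _ _).trans (add_le_add ((norm_add_le _ _).trans (add_le_add ?_ ?_)) ?_)
  · calc _ ≤ ‖At * (G' * D₁' * W₁' * D₂' * W₂' - J * (G * D₁ * W₁ * D₂ * W₂) * Jᴴ)‖ * ‖Atᴴ‖ := Matrix.l2_opNorm_mul _ _
      _ ≤ (‖At‖ * ‖G' * D₁' * W₁' * D₂' * W₂' - J * (G * D₁ * W₁ * D₂ * W₂) * Jᴴ‖) * 1 :=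
          mul_le_mul (Matrix.l2_opNorm_mul _ _) hAt' (norm_nonneg _) (mul_nonneg (norm_nonneg _) (norm_nonneg _))
      _ ≤ (1 * ((α * κ) * (α * κ) * pG + g * α * (α * κ) * pW + g * α * κ * α * pW)) * 1 := mul_le_mul_of_nonneg_right (mul_le_mul hAt hpl (norm_nonneg _) zero_le_one) zero_le_one
      _ = (α * κ) * (α * κ) * pG + g * α * (α * κ) * pW + g * α * κ * α * pW := by ring
  · calc _ ≤ ‖F * G * (D₁ * W₁ * D₂ * W₂)‖ * ‖(At * J)ᴴ‖ := Matrix.l2_opNorm_mul _ _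
      _ ≤ (‖F * G‖ * ‖D₁ * W₁ * D₂ * W₂‖) * 1 := mul_le_mul (Matrix.l2_opNorm_mul _ _) hAJn (norm_nonneg _) (mul_nonneg (norm_nonneg _) (norm_nonneg _))
      _ ≤ (f * ((α * κ) * (α * κ))) * 1 := mul_le_mul_of_nonneg_right (mul_le_mul hF h4 (norm_nonneg _) hf) zero_le_one
      _ = f * ((α * κ) * (α * κ)) := mul_one _
  · exact (Matrix.l2_opNorm_mul _ _).trans (mul_le_mul hGDWD hfW (norm_nonneg _) (by positivity))

end Bound

/-! ## §3 Along a tower -/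

section Tower

variable {ι : ℕ → Type*} [∀ k, Fintype (ι k)] [∀ k, DecidableEq (ι k)]
variable {Δ D₁ D₂ W₁ W₂ : (k : ℕ) → Matrix (ι k) (ι k) ℂ} {A : (k : ℕ) → Matrix (ι k) (ι (k + 1)) ℂ}
  {J : (k : ℕ) → Matrix (ι (k + 1)) (ι k) ℂ} {F : (k : ℕ) → Matrix (ι k) (ι k) ℂ} {r g α κ : ℝ} {e₀ e₁ f pG pW fW : ℕ → ℝ}

/-- **`oneStepAveragedLaw_plantedTwoWord` — THE ONE-STEP AVERAGED LAW OF `k ↦ Δ_k⁻¹D_{1,k}W_{1,k}D_{2,k}W_{2,k}` FROM THE PLANTED LETTERS** [our proof]. -/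
theorem oneStepAveragedLaw_plantedTwoWord (hr : 0 < r) (hfree : FreeTowerLaws Δ A J F r e₀ e₁ f) (hJJ : ∀ k, (J k)ᴴ * J k = 1)
    (hn₁ : ∀ k, D₁ (k + 1) * J k = J k * D₁ k) (hn₂ : ∀ k, D₂ (k + 1) * J k = J k * D₂ k) (hG : ∀ k, ‖(Δ k)⁻¹‖ ≤ g) (hD₁ : ∀ k, ‖D₁ k‖ ≤ α) (hD₂ : ∀ k, ‖D₂ k‖ ≤ α)
    (hW₁ : ∀ k, ‖W₁ k‖ ≤ κ) (hW₂ : ∀ k, ‖W₂ k‖ ≤ κ) (hpG : ∀ k, ‖(Δ (k + 1))⁻¹ - J k * (Δ k)⁻¹ * (J k)ᴴ‖ ≤ pG k)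
    (hpW₁ : ∀ k, ‖W₁ (k + 1) - J k * W₁ k * (J k)ᴴ‖ ≤ pW k) (hpW₂ : ∀ k, ‖W₂ (k + 1) - J k * W₂ k * (J k)ᴴ‖ ≤ pW k)
    (hfW : ∀ k, ‖W₂ k * (F k)ᴴ‖ ≤ fW k) :
    OneStepAveragedLaw A r (fun k => (Δ k)⁻¹ * D₁ k * W₁ k * D₂ k * W₂ k)
      (fun k => (α * κ) * (α * κ) * pG k + g * α * (α * κ) * pW k + g * α * κ * α * pW k + f k * ((α * κ) * (α * κ)) + g * α * κ * α * fW k) := by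
  intro k
  have hs0 : 0 < Real.sqrt r := Real.sqrt_pos.mpr hr
  set At : Matrix (ι k) (ι (k + 1)) ℂ := (((Real.sqrt r : ℝ) : ℂ)) • A k with hAt_def
  have hAt : ‖At‖ ≤ 1 := opNorm_normalised_le hr (hfree.opNorm_A_sq_le k)
  have hAJ : At * J k = 1 + F k := by rw [hAt_def, Matrix.smul_mul]; exact hfree.A_mul_J k
  have key := opNorm_planted_twoWord_sandwich_le (G := (Δ k)⁻¹) (G' := (Δ (k + 1))⁻¹) (D₁ := D₁ k) (D₁' := D₁ (k + 1)) (D₂ := D₂ k) (D₂' := D₂ (k + 1))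
    (W₁ := W₁ k) (W₁' := W₁ (k + 1)) (W₂ := W₂ k) (W₂' := W₂ (k + 1)) (J := J k) (hG k) (hD₁ k) (hD₁ (k + 1)) (hD₂ k) (hD₂ (k + 1)) (hW₁ k) (hW₁ (k + 1)) (hW₂ k) (hW₂ (k + 1))
    hAt (hfree.opNorm_J_le k) (hJJ k) hAJ (hn₁ k) (hn₂ k) (hpG k) (hpW₁ k) (hpW₂ k) (hfree.opNorm_F_mul_inv_le k) (hfW k)
  have hss : star ((((Real.sqrt r : ℝ) : ℂ))) = (((Real.sqrt r : ℝ) : ℂ)) := Complex.conj_ofReal _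
  have hsq : ((((Real.sqrt r : ℝ) : ℂ))) * (((Real.sqrt r : ℝ) : ℂ)) = (r : ℂ) := by
    rw [← Complex.ofReal_mul, Real.mul_self_sqrt hr.le]
  have hrC : (r : ℂ) ≠ 0 := by exact_mod_cast hr.ne'
  have e : A k * ((Δ (k + 1))⁻¹ * D₁ (k + 1) * W₁ (k + 1) * D₂ (k + 1) * W₂ (k + 1)) * (A k)ᴴ - ((r : ℂ))⁻¹ • ((Δ k)⁻¹ * D₁ k * W₁ k * D₂ k * W₂ k)
      = ((r : ℂ))⁻¹ • (At * ((Δ (k + 1))⁻¹ * D₁ (k + 1) * W₁ (k + 1) * D₂ (k + 1) * W₂ (k + 1)) * Atᴴ - (Δ k)⁻¹ * D₁ k * W₁ k * D₂ k * W₂ k) := by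
    rw [hAt_def, Matrix.conjTranspose_smul, hss, Matrix.smul_mul, Matrix.smul_mul, Matrix.mul_smul, smul_smul, hsq, smul_sub, smul_smul,
      inv_mul_cancel₀ hrC, one_smul]
  rw [e, norm_smul, norm_inv, Complex.norm_real, Real.norm_of_nonneg hr.le]
  exact mul_le_mul_of_nonneg_left key (inv_nonneg.mpr hr.le)

/-- **`towerLimitRate_plantedTwoWord` — THE TOWER LIMIT WITH RATE FOR THE TWO-INSERTION WORD WITH NESTED BOUNDED MULTIPLIERS** [our proof]: geometric letters
`p_G ≤ C_Gρ^k`, `p_W ≤ C_Wρ^k`, `f ≤ C_fρ^k`, `f_W ≤ C_{fW}ρ^k`, `ρ < 1` ⟹ `TowerLimitRate A r (k ↦ Δ_k⁻¹D_{1,k}W_{1,k}D_{2,k}W_{2,k}) ((ακ)²C_G + (gα(ακ) + gακα)C_W + (ακ)²C_f + gακα·C_{fW}) ρ`. -/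
theorem towerLimitRate_plantedTwoWord (hr : 0 < r) (hfree : FreeTowerLaws Δ A J F r e₀ e₁ f) (hJJ : ∀ k, (J k)ᴴ * J k = 1)
    (hn₁ : ∀ k, D₁ (k + 1) * J k = J k * D₁ k) (hn₂ : ∀ k, D₂ (k + 1) * J k = J k * D₂ k) (hG : ∀ k, ‖(Δ k)⁻¹‖ ≤ g) (hD₁ : ∀ k, ‖D₁ k‖ ≤ α) (hD₂ : ∀ k, ‖D₂ k‖ ≤ α)
    (hW₁ : ∀ k, ‖W₁ k‖ ≤ κ) (hW₂ : ∀ k, ‖W₂ k‖ ≤ κ) (hpG : ∀ k, ‖(Δ (k + 1))⁻¹ - J k * (Δ k)⁻¹ * (J k)ᴴ‖ ≤ pG k)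
    (hpW₁ : ∀ k, ‖W₁ (k + 1) - J k * W₁ k * (J k)ᴴ‖ ≤ pW k) (hpW₂ : ∀ k, ‖W₂ (k + 1) - J k * W₂ k * (J k)ᴴ‖ ≤ pW k)
    (hfW : ∀ k, ‖W₂ k * (F k)ᴴ‖ ≤ fW k)
    {ρ CG CW Cf CfW : ℝ} (hρ1 : ρ < 1) (hcG : ∀ k, pG k ≤ CG * ρ ^ k) (hcW : ∀ k, pW k ≤ CW * ρ ^ k) (hcf : ∀ k, f k ≤ Cf * ρ ^ k) (hcfW : ∀ k, fW k ≤ CfW * ρ ^ k) :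
    TowerLimitRate A r (fun k => (Δ k)⁻¹ * D₁ k * W₁ k * D₂ k * W₂ k)
      ((α * κ) * (α * κ) * CG + (g * α * (α * κ) + g * α * κ * α) * CW + (α * κ) * (α * κ) * Cf + g * α * κ * α * CfW) ρ := by
  have hg : 0 ≤ g := (norm_nonneg _).trans (hG 0)
  have hα : 0 ≤ α := (norm_nonneg _).trans (hD₁ 0)
  have hκ : 0 ≤ κ := (norm_nonneg _).trans (hW₁ 0)
  have hlaw : OneStepAveragedLaw A r (fun k => (Δ k)⁻¹ * D₁ k * W₁ k * D₂ k * W₂ k)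
      (fun k => ((α * κ) * (α * κ) * CG + (g * α * (α * κ) + g * α * κ * α) * CW + (α * κ) * (α * κ) * Cf + g * α * κ * α * CfW) * ρ ^ k) := by
    intro k
    refine (oneStepAveragedLaw_plantedTwoWord hr hfree hJJ hn₁ hn₂ hG hD₁ hD₂ hW₁ hW₂ hpG hpW₁ hpW₂ hfW k).trans (mul_le_mul_of_nonneg_left ?_ (inv_nonneg.mpr hr.le))
    have h1 : 0 ≤ (α * κ) * (α * κ) := by positivity
    have h2 : 0 ≤ g * α * (α * κ) := by positivity
    have h3 : 0 ≤ g * α * κ * α := by positivity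
    have a1 : (α * κ) * (α * κ) * pG k ≤ (α * κ) * (α * κ) * (CG * ρ ^ k) := mul_le_mul_of_nonneg_left (hcG k) h1
    have a2 : g * α * (α * κ) * pW k ≤ g * α * (α * κ) * (CW * ρ ^ k) := mul_le_mul_of_nonneg_left (hcW k) h2
    have a3 : g * α * κ * α * pW k ≤ g * α * κ * α * (CW * ρ ^ k) := mul_le_mul_of_nonneg_left (hcW k) h3
    have a4 : f k * ((α * κ) * (α * κ)) ≤ (Cf * ρ ^ k) * ((α * κ) * (α * κ)) := mul_le_mul_of_nonneg_right (hcf k) h1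
    have a5 : g * α * κ * α * fW k ≤ g * α * κ * α * (CfW * ρ ^ k) := mul_le_mul_of_nonneg_left (hcfW k) h3
    nlinarith [a1, a2, a3, a4, a5]
  exact towerLimitRate_of_oneStepAveragedLaw A hr hfree.opNorm_A_sq_le _ hρ1 hlaw

end Tower

end Summit.QuantumFields.BalabanUV.Beta.GAN24.PlantedTwoWordLaw

end
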